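import Summits.AnomalousDissipation.AnomalousDissipation.Theorems.MarginalStabilityChainStrainedLayerLawSumRuleLine
import HarnessLib

/-!
# Crux `MarginalStabilityChain.StrainedLayerLaw` (stmt-AnomalousDissipation-3007): objects, transfer and
# conditional composition of the line `FirstLemmasR2K4` (log-enstrophy clock + Nash roundness)

Support file (`--supports stmt-AnomalousDissipation-3007`; registered sub-goals `clockTransfer`, `floorTransfer_direct`,
`ofReal_negEnstrophy_le`).
Line lead a2 (`prover-line-stmt-AnomalousDissipation-3007-a2-0`, 2026-08-16), completing the planner's first-lemmas
file `Cruxes/StrainedLayerLaw/FirstLemmasR2K4.lean` (crux-ideate r2 k4, cards `log-enstrophy-clock-nash-roundness` and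
`ordered-ribbon-forged-core`) into a registrable skeleton. Contents:

* §0 objects of the line (the ideator's, verbatim): `negMass` (`M₋ = ∫∫ω₋`), `negEnstrophy` (`Ω₋ = ∫∫ω₋²`),
  `negPalinstrophy` (`P₋ = ∫∫_{ω<0}|∇ω|²`), iterated Bochner integrals over one period cell `(0, L] × ℝ`, built on the
  landed sum-rule vocabulary (`vorticity`, `SliceTails`, `ExpTails`, `IsAdmissible`, `InCruxClass`, p97772);
* §1 the LOG-ENSTROPHY CLOCK TRANSFER `clockTransfer` (pure real analysis, the ideator's theorem and proof verbatim):
  `Ω′ = Ω − 2νP`, `0 < Ω ≤ C`, `P ≥ 0`, `M ≥ L`, `r₀M²P ≤ Ω²` on `(t₀, ∞)` ⇒ `(r₀L²/2 − ε)T ≤ ∫_{t₀+1}^T νΩ` eventually;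
* §2 the DIRECT FLOOR TRANSFER `floorTransfer_direct` (abstract Cesàro lemma in `ℝ≥0∞`, proved): an eventual floor
  `ofReal((LK − ε)T) ≤ ofReal L · ∫⁻_{(1,T]} D` under local finiteness gives `ofReal K ≤ liminf_T ofReal T⁻¹ ∫⁻_{(0,T]} D`
  (no energy budget, no strain work: the clock line needs none);
* §3 DISSIPATION CONTROLS THE NEGATIVE ENSTROPHY (proved, hypothesis-free): `ofReal(νΩ₋) ≤ 2·(ofReal L · D)` pointwise in
  time, from `ω₋² ≤ ω² ≤ 2(u_y² + vₓ²)` and `ofReal ∫ ≤ ∫⁻ ofReal`;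
* the CONDITIONAL composition `StrainedLayerLaw_of_clockStubs` (hygiene + circulation floor + null zero set +
  negative-enstrophy law + fixed-ν a-priori bounds + ROUNDNESS FLOOR ⇒ the crux by name, `c = r⋆/4`) is the companion file
  `…ClockComposition.lean` (it imports this one).

No facts are asserted here (registered sub-goals `clockTransfer`, `floorTransfer_direct`, `ofReal_negEnstrophy_le`); the
stubs live in the skeleton (`Cruxes/StrainedLayerLaw/Lines/FirstLemmasR2K4.lean`) and in the stub files. References: idea card `Cruxes/StrainedLayerLaw/Ideas/log-enstrophy-clock-nash-roundness.md`; route file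
`Theses/MarginalStabilityChain.lean` (item 3007); `Literature/Analysis/FluidPDE/StretchedLayerNS.lean`.
-/

-- `Summit.<Summit>.<Problem>` is the tree's mandated summit-side namespace (CONVENTIONS §2); for this
-- single-conjunct summit the two coincide, so the duplicate is deliberate.
set_option linter.dupNamespace false

noncomputable section

open scoped Topology ENNReal
open Filter Set Function MeasureTheory

namespace Summit.AnomalousDissipation.AnomalousDissipation.Theorems.StrainedLayerLaw.LogEnstrophyClock

open Literature.Analysis.FluidPDE Literature.Analysis.FluidPDE.StretchedLayer
open Summit.AnomalousDissipation.AnomalousDissipation.Theses.MarginalStabilityChain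
open Summit.AnomalousDissipation.AnomalousDissipation.Theorems.StrainedLayerLaw.StrainWorkSumRule

/-! ## §0 Objects of the line -/

/-- Mass of the NEGATIVE vorticity of a plane slice over one period cell: `M₋ = ∫_{x ∈ (0,L]} ∫_y ω₋`,
`ω₋ = max(−ω, 0)` (iterated Bochner integrals; the layer's vorticity is negative, and `M₋ ≥ L` under shear tails by
the circulation budget). [folklore] -/
def negMass (L : ℝ) (u v : ℝ → ℝ → ℝ) : ℝ :=
  ∫ x in Ioc 0 L, ∫ y, max (-(vorticity u v x y)) 0

/-- Enstrophy of the negative vorticity of a slice over one period cell: `Ω₋ = ∫_{x ∈ (0,L]} ∫_y ω₋²`. [folklore] -/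
def negEnstrophy (L : ℝ) (u v : ℝ → ℝ → ℝ) : ℝ :=
  ∫ x in Ioc 0 L, ∫ y, (max (-(vorticity u v x y)) 0) ^ 2

/-- Palinstrophy of the negative vorticity of a slice over one period cell: `P₋ = ∫_{x ∈ (0,L]} ∫_{y : ω < 0} |∇ω|²`
(slice derivatives `dX`, `dY` of the vorticity). [folklore] -/
def negPalinstrophy (L : ℝ) (u v : ℝ → ℝ → ℝ) : ℝ :=
  ∫ x in Ioc 0 L, ∫ y,
    if vorticity u v x y < 0 then (dX (vorticity u v) x y) ^ 2 + (dY (vorticity u v) x y) ^ 2 else 0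

/-- The negative enstrophy is nonnegative (integrand `ω₋² ≥ 0`; Bochner junk is `0`). [folklore] -/
theorem negEnstrophy_nonneg (L : ℝ) (u v : ℝ → ℝ → ℝ) : 0 ≤ negEnstrophy L u v :=
  integral_nonneg fun _ => integral_nonneg fun _ => sq_nonneg _

/-- The negative palinstrophy is nonnegative (integrand `1_{ω<0}|∇ω|² ≥ 0`). [folklore] -/
theorem negPalinstrophy_nonneg (L : ℝ) (u v : ℝ → ℝ → ℝ) : 0 ≤ negPalinstrophy L u v := by
  refine integral_nonneg fun _ => integral_nonneg fun _ => ?_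
  simp only [Pi.zero_apply]
  split_ifs <;> positivity

/-! ## §1 The log-enstrophy clock transfer (the ideator's theorem B4, proof verbatim) -/

/-- **Log-enstrophy clock transfer (pure real analysis).** If `Ω′ = Ω − 2νP` on `(t₀, ∞)`, `0 < Ω ≤ C`, `M ≥ L > 0`,
`P ≥ 0` and the roundness floor `r₀ M² P ≤ Ω²` holds there, then for every `ε > 0`, eventually
`(r₀L²/2 − ε)·T ≤ ∫_{t₀+1}^T ν Ω`. Proof: `g = log Ω − t + (2ν/(r₀L²))∫Ω` has
`g′ = 1 − 2νP/Ω − 1 + (2ν/(r₀L²))Ω ≥ 0` by the floor, so `g` is monotone; unpack between `t₀ + 1` and `T` and use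
`log Ω(T) ≤ log C`. (Planner crux-ideate r2 k4, `FirstLemmasR2K4.lean` §B4, verbatim.) [folklore] -/
theorem clockTransfer {ν L r₀ t₀ C : ℝ} {Ω P M : ℝ → ℝ}
    (hν : 0 < ν) (hL : 0 < L) (hr : 0 < r₀)
    (hΩ : ∀ t, t₀ < t → HasDerivAt Ω (Ω t - 2 * ν * P t) t)
    (hpos : ∀ t, t₀ < t → 0 < Ω t) (hbd : ∀ t, t₀ < t → Ω t ≤ C)
    (hP : ∀ t, t₀ < t → 0 ≤ P t) (hM : ∀ t, t₀ < t → L ≤ M t)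
    (hround : ∀ t, t₀ < t → r₀ * (M t) ^ 2 * P t ≤ (Ω t) ^ 2) :
    ∀ ε : ℝ, 0 < ε → ∀ᶠ T in atTop, (r₀ * L ^ 2 / 2 - ε) * T ≤ ∫ t in (t₀ + 1)..T, ν * Ω t := by
  intro ε hε
  set t₁ : ℝ := t₀ + 1 with ht₁
  have ht₁' : t₀ < t₁ := by rw [ht₁]; linarith
  -- continuity / measurability / integrability of `Ω` on the open half-line
  have hcont : ContinuousOn Ω (Ioi t₀) := fun t ht => (hΩ t ht).continuousAt.continuousWithinAt
  have hmeas : ∀ t ∈ Ioi t₀, StronglyMeasurableAtFilter Ω (𝓝 t) volume :=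
    ContinuousOn.stronglyMeasurableAtFilter isOpen_Ioi hcont
  have hint : ∀ a b : ℝ, t₀ < a → t₀ < b → IntervalIntegrable Ω volume a b := by
    intro a b ha hb
    refine ContinuousOn.intervalIntegrable (hcont.mono ?_)
    intro x hx
    rcases mem_uIcc.1 hx with ⟨h1, -⟩ | ⟨h1, -⟩ <;> simp only [mem_Ioi] <;> linarith
  -- the primitive `F` of `Ω` from `t₁` and its derivative
  set F : ℝ → ℝ := fun t => ∫ s in t₁..t, Ω s with hF
  have hFd : ∀ t, t₀ < t → HasDerivAt F (Ω t) t := fun t ht =>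
    intervalIntegral.integral_hasDerivAt_right (hint t₁ t ht₁' ht) (hmeas t ht) (hΩ t ht).continuousAt
  -- the Lyapunov-type function `g = log Ω − t + c F`, `c = 2ν/(r₀L²)`
  set c : ℝ := 2 * ν / (r₀ * L ^ 2) with hc
  have hcpos : 0 < c := by rw [hc]; positivity
  set g : ℝ → ℝ := fun t => Real.log (Ω t) - t + c * F t with hg
  have hgd : ∀ t, t₀ < t →
      HasDerivAt g ((Ω t - 2 * ν * P t) / Ω t - 1 + c * Ω t) t := by
    intro t ht
    have h1 : HasDerivAt (fun s => Real.log (Ω s)) ((Ω t - 2 * ν * P t) / Ω t) t :=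
      (hΩ t ht).log (hpos t ht).ne'
    have h2 : HasDerivAt (fun s : ℝ => s) 1 t := hasDerivAt_id t
    have h3 : HasDerivAt (fun s => c * F s) (c * Ω t) t := (hFd t ht).const_mul c
    exact (h1.sub h2).add h3
  -- its derivative is nonnegative thanks to the roundness floor
  have hgd_nonneg : ∀ t, t₀ < t → 0 ≤ (Ω t - 2 * ν * P t) / Ω t - 1 + c * Ω t := by
    intro t ht
    have hΩt := hpos t ht
    have hMt : L ≤ M t := hM t ht
    have hPt := hP t ht
    have hL2 : L ^ 2 ≤ (M t) ^ 2 := by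
      have : 0 ≤ M t := hL.le.trans hMt
      nlinarith
    have h1 : r₀ * L ^ 2 * P t ≤ (Ω t) ^ 2 := by
      have : r₀ * L ^ 2 * P t ≤ r₀ * (M t) ^ 2 * P t := by
        have := mul_le_mul_of_nonneg_left hL2 hr.le
        exact mul_le_mul_of_nonneg_right this hPt
      exact this.trans (hround t ht)
    have heq : (Ω t - 2 * ν * P t) / Ω t - 1 + c * Ω t =
        2 * ν * ((Ω t) ^ 2 - r₀ * L ^ 2 * P t) / (r₀ * L ^ 2 * Ω t) := by
      rw [hc]
      field_simp
      ring
    rw [heq]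
    apply div_nonneg
    · exact mul_nonneg (by positivity) (sub_nonneg.2 h1)
    · positivity
  -- hence `g` is monotone on `[t₁, ∞)`
  have hmono : MonotoneOn g (Ici t₁) := by
    refine monotoneOn_of_hasDerivWithinAt_nonneg (f' := fun t => (Ω t - 2 * ν * P t) / Ω t - 1 + c * Ω t)
      (convex_Ici t₁) (fun t ht => (hgd t (ht₁'.trans_le ht)).continuousAt.continuousWithinAt) ?_ ?_
    · intro t ht
      rw [interior_Ici] at ht ⊢
      exact (hgd t (ht₁'.trans ht)).hasDerivWithinAt
    · intro t ht
      rw [interior_Ici] at ht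
      exact hgd_nonneg t (ht₁'.trans ht)
  -- unpack monotonicity between `t₁` and `T ≥ t₁`
  have hF0 : F t₁ = 0 := by simp [hF]
  have key : ∀ T, t₁ ≤ T → (T - t₁) + Real.log (Ω t₁) - Real.log C ≤ c * F T := by
    intro T hT
    have hm := hmono (self_mem_Ici) (mem_Ici.2 hT) hT
    simp only [hg, hF0, mul_zero, add_zero] at hm
    have hlog : Real.log (Ω T) ≤ Real.log C :=
      Real.log_le_log (hpos T (ht₁'.trans_le hT)) (hbd T (ht₁'.trans_le hT))
    linarith
  -- conclude: eventually `(r₀L²/2 − ε) T ≤ ν F T = ∫_{t₁}^T ν Ω`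
  set K : ℝ := t₁ - Real.log (Ω t₁) + Real.log C with hK
  have hcL : ν = c * (r₀ * L ^ 2 / 2) := by
    rw [hc]; field_simp
  refine eventually_atTop.2 ⟨max t₁ (|K| * (r₀ * L ^ 2 / 2) / ε + 1), fun T hT => ?_⟩
  have hT1 : t₁ ≤ T := le_of_max_le_left hT
  have hT2 : |K| * (r₀ * L ^ 2 / 2) / ε + 1 ≤ T := le_of_max_le_right hT
  have hkey := key T hT1
  rw [intervalIntegral.integral_const_mul]
  change (r₀ * L ^ 2 / 2 - ε) * T ≤ ν * F T
  have hA : 0 < r₀ * L ^ 2 / 2 := by positivity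
  -- from `key`: ν F T ≥ (r₀L²/2) (T − K)
  have h1 : (r₀ * L ^ 2 / 2) * (T - K) ≤ ν * F T := by
    have := mul_le_mul_of_nonneg_left hkey hA.le
    calc (r₀ * L ^ 2 / 2) * (T - K) = (r₀ * L ^ 2 / 2) * ((T - t₁) + Real.log (Ω t₁) - Real.log C) := by
            rw [hK]; ring
      _ ≤ (r₀ * L ^ 2 / 2) * (c * F T) := this
      _ = ν * F T := by rw [hcL]; ring
  -- and `ε T ≥ (r₀L²/2) K` for `T` large
  have h2 : (r₀ * L ^ 2 / 2) * K ≤ ε * T := by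
    have hKabs : K ≤ |K| := le_abs_self K
    have hT3 : |K| * (r₀ * L ^ 2 / 2) / ε ≤ T := by linarith
    have := (div_le_iff₀ hε).1 hT3
    nlinarith [abs_nonneg K]
  nlinarith [h1, h2]

/-! ## §2 The direct floor transfer (abstract Cesàro lemma in `ℝ≥0∞`, proved) -/

/-- **Direct floor transfer.** For any `D : ℝ → [0,∞]` and real `K` (`L > 0`): if local finiteness of `∫⁻_{(0,T]} D`
forces, for every `ε > 0`, the eventual floor `ofReal((LK − ε)T) ≤ ofReal L · ∫⁻_{(1,T]} D`, then
`ofReal K ≤ liminf_T ofReal T⁻¹ ∫⁻_{(0,T]} D`. (If some `∫⁻_{(0,T₀]} D = ⊤` the Cesàro means are eventually `⊤`;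
otherwise divide the floor by `ofReal L` and by `T` to get `ofReal (K − δ) ≤` the mean eventually, for every `δ > 0`,
then `δ → 0⁺`.) Variant of the sum-rule line's `floorTransfer` without energy and strain work. [folklore] -/
theorem floorTransfer_direct (L K : ℝ) (D : ℝ → ℝ≥0∞) (hL : 0 < L)
    (h : (∀ T : ℝ, 0 < T → ∫⁻ t in Ioc 0 T, D t ≠ ∞) →
      ∀ ε : ℝ, 0 < ε → ∀ᶠ T in atTop,
        ENNReal.ofReal ((L * K - ε) * T) ≤ ENNReal.ofReal L * ∫⁻ t in Ioc 1 T, D t) :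
    ENNReal.ofReal K ≤ liminf (fun T : ℝ => ENNReal.ofReal T⁻¹ * ∫⁻ t in Ioc 0 T, D t) atTop := by
  by_cases hfin : ∀ T : ℝ, 0 < T → ∫⁻ t in Ioc 0 T, D t ≠ ∞
  swap
  · -- some initial dissipation integral is infinite: the Cesàro means are eventually `⊤`
    push Not at hfin
    obtain ⟨T₀, hT₀, htop⟩ := hfin
    have hev : ∀ᶠ T in atTop, ENNReal.ofReal T⁻¹ * ∫⁻ t in Ioc 0 T, D t = (⊤ : ℝ≥0∞) := by
      filter_upwards [eventually_ge_atTop T₀] with T hT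
      have hmono : ∫⁻ t in Ioc 0 T₀, D t ≤ ∫⁻ t in Ioc 0 T, D t :=
        lintegral_mono_set (Ioc_subset_Ioc_right hT)
      rw [htop, top_le_iff] at hmono
      rw [hmono, ENNReal.mul_top]
      exact (ENNReal.ofReal_pos.mpr (inv_pos.mpr (hT₀.trans_le hT))).ne'
    rw [Filter.liminf_congr hev, Filter.liminf_const]
    exact le_top
  · have hfl := h hfin
    have key : ∀ δ : ℝ, 0 < δ → ENNReal.ofReal (K - δ) ≤
        liminf (fun T : ℝ => ENNReal.ofReal T⁻¹ * ∫⁻ t in Ioc 0 T, D t) atTop := by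
      intro δ hδ
      refine le_liminf_of_le (h := ?_)
      filter_upwards [hfl (L * δ) (by positivity), eventually_gt_atTop (0:ℝ)] with T hT hT0
      have hsub : Ioc 1 T ⊆ Ioc 0 T := Ioc_subset_Ioc_left zero_le_one
      have hI_le : ∫⁻ t in Ioc 1 T, D t ≤ ∫⁻ t in Ioc 0 T, D t := lintegral_mono_set hsub
      have hLne : ENNReal.ofReal L ≠ 0 := (ENNReal.ofReal_pos.mpr hL).ne'
      -- `ofReal L * ofReal ((K − δ) T) ≤ ofReal L * ∫⁻_{(0,T]} D`
      have h1 : ENNReal.ofReal L * ENNReal.ofReal ((K - δ) * T) ≤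
          ENNReal.ofReal L * ∫⁻ t in Ioc 0 T, D t := by
        calc ENNReal.ofReal L * ENNReal.ofReal ((K - δ) * T)
            = ENNReal.ofReal ((L * K - L * δ) * T) := by
              rw [← ENNReal.ofReal_mul hL.le]; congr 1; ring
          _ ≤ ENNReal.ofReal L * ∫⁻ t in Ioc 1 T, D t := hT
          _ ≤ ENNReal.ofReal L * ∫⁻ t in Ioc 0 T, D t := by gcongr
      have h2 : ENNReal.ofReal ((K - δ) * T) ≤ ∫⁻ t in Ioc 0 T, D t :=
        (ENNReal.mul_le_mul_iff_right hLne ENNReal.ofReal_ne_top).1 h1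
      have hKδ : ENNReal.ofReal (K - δ) = ENNReal.ofReal T⁻¹ * ENNReal.ofReal ((K - δ) * T) := by
        rw [← ENNReal.ofReal_mul (inv_nonneg.mpr hT0.le)]
        congr 1
        field_simp
      calc ENNReal.ofReal (K - δ)
          = ENNReal.ofReal T⁻¹ * ENNReal.ofReal ((K - δ) * T) := hKδ
        _ ≤ ENNReal.ofReal T⁻¹ * ∫⁻ t in Ioc 0 T, D t := by gcongr
    have htend : Tendsto (fun δ : ℝ => ENNReal.ofReal (K - δ)) (𝓝[>] 0)
        (𝓝 (ENNReal.ofReal K)) := by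
      have h1 : Tendsto (fun δ : ℝ => K - δ) (𝓝 (0:ℝ)) (𝓝 (K - 0)) :=
        tendsto_const_nhds.sub tendsto_id
      rw [sub_zero] at h1
      exact (ENNReal.tendsto_ofReal h1).mono_left nhdsWithin_le_nhds
    refine le_of_tendsto htend ?_
    filter_upwards [self_mem_nhdsWithin] with δ hδ
    exact key δ hδ

/-! ## §3 The dissipation controls the negative enstrophy (proved, hypothesis-free) -/

/-- Pointwise: `ω₋² ≤ 2 (uₓ² + u_y² + vₓ² + v_y²)` (`ω = vₓ − u_y`, `(a − b)² ≤ 2(a² + b²)`). [folklore] -/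
theorem negPart_vorticity_sq_le (u v : ℝ → ℝ → ℝ) (x y : ℝ) :
    (max (-(vorticity u v x y)) 0) ^ 2 ≤
      2 * (dX u x y ^ 2 + dY u x y ^ 2 + dX v x y ^ 2 + dY v x y ^ 2) := by
  have h1 : (max (-(vorticity u v x y)) 0) ^ 2 ≤ (vorticity u v x y) ^ 2 := by
    rcases le_or_gt 0 (-(vorticity u v x y)) with h | h
    · rw [max_eq_left h]; ring_nf; exact le_rfl
    · rw [max_eq_right h.le]
      simp only [ne_eq, OfNat.ofNat_ne_zero, not_false_eq_true, zero_pow]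
      exact sq_nonneg _
  have h2 : (vorticity u v x y) ^ 2 ≤ 2 * (dX u x y ^ 2 + dY u x y ^ 2 + dX v x y ^ 2 + dY v x y ^ 2) := by
    simp only [StrainWorkSumRule.vorticity]
    nlinarith [sq_nonneg (dX v x y + dY u x y), sq_nonneg (dX u x y), sq_nonneg (dY v x y)]
  exact h1.trans h2

/-- `ENNReal.ofReal (∫ f) ≤ ∫⁻ ENNReal.ofReal ∘ f` for every real `f` (the left side is `0` for non-integrable
`f`). Private copy of the tree's `Literature.Analysis.FunctionSpaces.ofReal_integral_le_lintegral_ofReal'`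
(`WeakL1LimitsProofs.lean`, not in this file's import closure). [folklore] -/
private theorem ofReal_integral_le_lintegral_ofReal' {α : Type*} [MeasurableSpace α] {μ : Measure α}
    (f : α → ℝ) : ENNReal.ofReal (∫ a, f a ∂μ) ≤ ∫⁻ a, ENNReal.ofReal (f a) ∂μ := by
  by_cases hf : Integrable f μ
  · calc ENNReal.ofReal (∫ a, f a ∂μ) ≤ ENNReal.ofReal (∫ a, max (f a) 0 ∂μ) :=
          ENNReal.ofReal_le_ofReal (integral_mono hf hf.pos_part fun a => le_max_left _ _)
      _ = ∫⁻ a, ENNReal.ofReal (max (f a) 0) ∂μ :=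
          ofReal_integral_eq_lintegral_ofReal hf.pos_part
            (Eventually.of_forall fun a => le_max_right _ _)
      _ = ∫⁻ a, ENNReal.ofReal (f a) ∂μ := lintegral_congr fun a => by
          rcases le_total (f a) 0 with h | h
          · rw [max_eq_right h, ENNReal.ofReal_zero, ENNReal.ofReal_of_nonpos h]
          · rw [max_eq_left h]
  · rw [integral_undef hf, ENNReal.ofReal_zero]
    exact zero_le

/-- **The dissipation controls the negative enstrophy**: `ofReal (ν Ω₋) ≤ 2 · (ofReal L · D)` for every slice
(`ν ≥ 0`, `L > 0`), with NO integrability or tails hypothesis — `ofReal ∫ f ≤ ∫⁻ ofReal f` for the two iterated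
Bochner integrals (junk `0` only helps) and the pointwise bound `ω₋² ≤ 2|∇(u,v)|²`. [folklore] -/
theorem ofReal_negEnstrophy_le {ν L : ℝ} (hν : 0 ≤ ν) (hL : 0 < L) (u v : ℝ → ℝ → ℝ) :
    ENNReal.ofReal (ν * negEnstrophy L u v) ≤ 2 * (ENNReal.ofReal L * layerDissipation ν L u v) := by
  -- rewrite the right-hand side as `ofReal ν * (2 * ∫⁻∫⁻ |∇|²)`
  set G : ℝ → ℝ → ℝ := fun x y => dX u x y ^ 2 + dY u x y ^ 2 + dX v x y ^ 2 + dY v x y ^ 2 with hG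
  have hLD : ENNReal.ofReal L * layerDissipation ν L u v =
      ENNReal.ofReal ν * ∫⁻ x in Ioc 0 L, ∫⁻ y, ENNReal.ofReal (G x y) := by
    rw [layerDissipation_def, ← mul_assoc, ← ENNReal.ofReal_mul hL.le, mul_div_cancel₀ _ hL.ne']
  rw [hLD, ENNReal.ofReal_mul hν]
  calc ENNReal.ofReal ν * ENNReal.ofReal (negEnstrophy L u v)
      ≤ ENNReal.ofReal ν * (2 * ∫⁻ x in Ioc 0 L, ∫⁻ y, ENNReal.ofReal (G x y)) := by
        gcongr
        -- `ofReal Ω₋ ≤ ∫⁻ x, ofReal (∫ y, ω₋²) ≤ ∫⁻ x, ∫⁻ y, ofReal ω₋² ≤ 2 ∫⁻∫⁻ ofReal G`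
        calc ENNReal.ofReal (negEnstrophy L u v)
            ≤ ∫⁻ x in Ioc 0 L, ENNReal.ofReal (∫ y, (max (-(vorticity u v x y)) 0) ^ 2) :=
              ofReal_integral_le_lintegral_ofReal' _
          _ ≤ ∫⁻ x in Ioc 0 L, ∫⁻ y, ENNReal.ofReal ((max (-(vorticity u v x y)) 0) ^ 2) :=
              lintegral_mono fun x => ofReal_integral_le_lintegral_ofReal' _
          _ ≤ ∫⁻ x in Ioc 0 L, ∫⁻ y, 2 * ENNReal.ofReal (G x y) := by
              refine lintegral_mono fun x => lintegral_mono fun y => ?_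
              rw [show (2 : ℝ≥0∞) = ENNReal.ofReal 2 by simp, ← ENNReal.ofReal_mul zero_le_two]
              exact ENNReal.ofReal_le_ofReal (negPart_vorticity_sq_le u v x y)
          _ = 2 * ∫⁻ x in Ioc 0 L, ∫⁻ y, ENNReal.ofReal (G x y) := by
              rw [← lintegral_const_mul' _ _ ENNReal.ofNat_ne_top]
              congr 1; funext x
              rw [lintegral_const_mul' _ _ ENNReal.ofNat_ne_top]
    _ = 2 * (ENNReal.ofReal ν * ∫⁻ x in Ioc 0 L, ∫⁻ y, ENNReal.ofReal (G x y)) := by ring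


end Summit.AnomalousDissipation.AnomalousDissipation.Theorems.StrainedLayerLaw.LogEnstrophyClock

end
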